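import Literature.NumberTheory.QuadraticFields.RealQuadraticInfrastructureDistance
import Literature.Computability.Cryptography.InfrastructurePrimitives
import HarnessLib

/-!
# Crude bounds on the regulator of a real quadratic order

Topic `Computability/Cryptography` (parameter sizing for Hallgren's algorithm; Jozsa 2003, §3:
"R can be exponentially large in log d", and §9: the walk parameters are polynomial in log D).
For a non-square discriminant `D ≡ 0, 1 (mod 4)` with fundamental unit `ε`:

* `periodLength_le_sq` — the principal cycle has at most `(2D + 2)²` elements (its elements are
  distinct reduced quotients `(P, Q)` with `1 ≤ P ≤ D`, `1 ≤ Q ≤ 2D + 1`);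
* **`log_fundUnit_le`** — `R = log ε ≤ (2D + 2)² (1 + log D)` (each gap is `< log(2√D) ≤ 1 + log D`);
* **`log_two_lt_two_mul_log_fundUnit`** — `log 2 < 2R` (two consecutive gaps exceed `log 2`).

Theorem file, no named facts.

## References

* R. Jozsa, arXiv:quant-ph/0302134 (2003), §3, §7 Props. 31–32. [Jozsa2003]
* M. J. Jacobson, Jr., H. C. Williams, *Solving the Pell Equation*, Springer (2009), §7.4. [JacobsonWilliams2008]
-/

noncomputable section

open scoped Classical

namespace Literature.Computability.Cryptography

namespace HallgrenRegulator

open Literature.NumberTheory.QuadraticFields Literature.NumberTheory.QuadraticFields.QuadIrr Finset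

variable {D : ℕ} (hD : ¬ IsSquare D) (hD4 : D % 4 = 0 ∨ D % 4 = 1)
include hD hD4

/-- **The principal cycle is short**: `p ≤ (2D + 2)²`. [cite: Jozsa2003, §6.1 Prop. 17 (finitely many reduced forms)] -/
theorem periodLength_le_sq : periodLength D ≤ (2 * D + 2) ^ 2 := by
  -- the cycle elements `x_{k+1}`, `k < p`, are distinct and live in a box of that size
  set f : ℕ → ℕ × ℕ := fun k => ((step^[k] (principalFirst D)).P.toNat, (step^[k] (principalFirst D)).Q.toNat) with hf
  have hinj : Set.InjOn f (Set.Iio (periodLength D)) := by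
    intro i hi j hj h
    have hred := fun k => isReduced_iterate hD (isReduced_principalFirst hD hD4) k
    have hx : step^[i] (principalFirst D) = step^[j] (principalFirst D) := by
      simp only [hf, Prod.mk.injEq] at h
      obtain ⟨h1, h2⟩ := h
      have hP : (step^[i] (principalFirst D)).P = (step^[j] (principalFirst D)).P := by
        have := Int.toNat_of_nonneg (hred i).P_pos.le
        have := Int.toNat_of_nonneg (hred j).P_pos.le
        omega
      have hQ : (step^[i] (principalFirst D)).Q = (step^[j] (principalFirst D)).Q := by
        have := Int.toNat_of_nonneg (hred i).1.le
        have := Int.toNat_of_nonneg (hred j).1.le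
        omega
      exact QuadIrr.ext hP hQ
    exact (Function.iterate_eq_iterate_iff_of_lt_minimalPeriod hi hj).mp hx
  have hmaps : Set.MapsTo f (Set.Iio (periodLength D)) ((range (2 * D + 2) ×ˢ range (2 * D + 2) : Finset (ℕ × ℕ)) : Set (ℕ × ℕ)) := by
    intro k _
    have hred := isReduced_iterate hD (isReduced_principalFirst hD hD4) k
    obtain ⟨h1, -, h3⟩ := InfraPrimitives.IsReduced.size hred
    simp only [coe_product, coe_range, Set.mem_prod, Set.mem_Iio, hf]
    constructor
    · have := Int.toNat_of_nonneg hred.P_pos.le; omega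
    · have := Int.toNat_of_nonneg hred.1.le; omega
  have hcard := Set.ncard_le_ncard_of_injOn f (s := Set.Iio (periodLength D)) hmaps hinj (Finset.finite_toSet _)
  rw [Set.ncard_coe_finset, card_product, card_range, Set.ncard_eq_toFinset_card', Set.toFinset_Iio] at hcard
  simpa [sq] using hcard

/-- **`R ≤ (2D + 2)² (1 + log D)`.** [cite: Jozsa2003, §3 (R may be as large as O(√d log d))] -/
theorem log_fundUnit_le : Real.log (fundUnit D) ≤ ((2 * D + 2) ^ 2 : ℕ) * (1 + Real.log D) := by
  rw [← pos_periodLength hD hD4]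
  unfold pos
  have hD1 : (1 : ℝ) ≤ D := by exact_mod_cast le_trans (by norm_num) (five_le hD hD4)
  have hgap : ∀ j ∈ range (periodLength D), gap D j ≤ 1 + Real.log D := by
    intro j _
    have h := gap_lt hD hD4 j
    have : Real.log (2 * Real.sqrt D) ≤ 1 + Real.log D := by
      rw [Real.log_mul (by norm_num) (by positivity), Real.log_sqrt (by positivity)]
      have := Real.log_le_sub_one_of_pos (by norm_num : (0 : ℝ) < 2)
      have : 0 ≤ Real.log D := Real.log_nonneg hD1
      linarith
    linarith
  calc ∑ j ∈ range (periodLength D), gap D j ≤ ∑ _j ∈ range (periodLength D), (1 + Real.log D) := sum_le_sum hgap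
    _ = (periodLength D : ℝ) * (1 + Real.log D) := by rw [sum_const, card_range, nsmul_eq_mul]
    _ ≤ ((2 * D + 2) ^ 2 : ℕ) * (1 + Real.log D) := by
        have : 0 ≤ 1 + Real.log D := by have := Real.log_nonneg hD1; linarith
        exact mul_le_mul_of_nonneg_right (by exact_mod_cast periodLength_le_sq hD hD4) this

/-- **`log 2 < 2R`**: two consecutive gaps exceed `log 2`, and `pos 2 ≤ 2R`. [cite: Jozsa2003, §7 Prop. 32] -/
theorem log_two_lt_two_mul_log_fundUnit : Real.log 2 < 2 * Real.log (fundUnit D) := by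
  have h2 : Real.log 2 < pos D 2 := by
    have := log_two_lt_gap_add_gap_succ hD hD4 0
    rw [pos_succ, pos_succ]; simp [pos] at this ⊢; linarith
  -- `pos 2 ≤ pos (2p) = 2R`
  have hmono := pos_mono hD hD4 (show 2 ≤ 2 * periodLength D by have := periodLength_pos hD hD4; omega)
  have h2p : pos D (2 * periodLength D) = 2 * Real.log (fundUnit D) := by
    have := pos_add_mul_periodLength hD hD4 0 2
    simp only [zero_add] at this
    rw [this]; simp [pos]
  linarith

end HallgrenRegulator

end Literature.Computability.Cryptography

end
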